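import Mathlib
import Summits.NavierStokesRegularity.NavierStokesRegularity.Theorems.LerayQuarterDissipationFiniteDissipationLiouvilleCrossFlowThreshold
import Summits.NavierStokesRegularity.NavierStokesRegularity.Theorems.LerayQuarterDissipationFiniteDissipationLiouvilleThresholdSecondDerivatives
import Summits.NavierStokesRegularity.NavierStokesRegularity.Theorems.LerayQuarterDissipationFiniteDissipationLiouvilleHullCategoryDilate
import HarnessLib

/-!
# Crux `FiniteDissipationLiouville` (stmt-NavierStokesRegularity-22144): THE ANTITONE-ENSTROPHY
# ENDPOINT SCHEME — a reusable zoom-out Liouville template for threshold rows at their endpoint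

Theorems file of route `LerayQuarterDissipation` (lead prover g18; `--supports` the crux).
Navier–Stokes regularity is NOT proved by anything here; no summit is.

Lead g17 settled the cross-flow threshold ONE (`…CrossFlowThreshold.eq_zero_of_crossFlow_le_one`)
by the argument: hypothesis ⇒ the global similarity enstrophy `Z_V(s) = ∫‖Ω(s)‖²` is NON-INCREASING;
bounded and antitone, `Z_V ↑ m` as `s → −∞`; the zoom-out sequence `V_{e^j}` has a KNSS limit `W`
in the same class, with the same hypothesis, and with CONSTANT enstrophy `Z_W ≡ m`; the equality
case kills `W`, so `m = 0`, `Z_V ≡ 0`, `V ≡ 0`. This file ABSTRACTS that argument over the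
hypothesis, as a predicate `P` on fields, so that every law-free threshold row of the tree whose
slack is pointwise nonnegative at the endpoint becomes a one-page instantiation:

* `tendstoUniformlyOn_slabPieces_nsRescale` — uniform convergence on the slab pieces passes to a
  fixed parabolic rescaling of the sequence and of the limit (dilated pieces lie in larger pieces,
  `…HullCategory.slabPiece_mapsTo_dilate`);
* `fderiv_curl_nsRescale`, `curl_curl_nsRescale` — `D(curl V_c(s)) = c³ D(curl V(c²s))(c·)`,
  `curl curl V_c(s) = c³ curl curl V(c²s)(c·)` (hypothesis-free chain rules);
* **`tendsto_curl_curl_of_unif`** — along a sequence of KNSS-gauge Type-I fields with a common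
  constant converging uniformly on the slab pieces to a field of the class, the SECOND vorticity
  derivatives converge pointwise at EVERY `t < 0` (g14's `…ThresholdOne.tendsto_fderiv_curl_slice`
  at `t = −1`, transported by rescaling);
* **`eq_zero_of_antitone_scheme`** — THE SCHEME: let `P` be a property of fields which is
  (i) invariant under parabolic rescalings, (ii) closed under the KNSS convergence of
  `…Compactness.seqLimit` inside the enveloped class with constant `C`, (iii) makes the global
  similarity enstrophy of every enveloped member antitone, and (iv) kills every enveloped member
  whose similarity enstrophy is constant; then `P` kills every KNSS-gauge Type-I field with a Type-I
  envelope (constants equalised to `C`).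

HONEST FRAMING. A bookkeeping abstraction of an argument already in the tree (g17), about
HYPOTHETICAL objects; by itself it removes nothing from the catalogued DSS wall. Nothing here bears
on Navier–Stokes regularity or blow-up.

References: Koch–Nadirashvili–Seregin–Šverák, Acta Math. 203 (2009) §4 (compactness of the class);
Chae–Wolf, arXiv:1610.09464 §4; folklore energy method.
-/

noncomputable section

set_option linter.dupNamespace false

namespace Summit.NavierStokesRegularity.NavierStokesRegularity.Theorems.FiniteDissipationLiouville.EndpointScheme

open MeasureTheory Set Filter Topology Metric InnerProductSpace Function Real
open scoped RealInnerProductSpace ContDiff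
open Literature.Analysis Literature.Analysis.FluidPDE
open Summit.NavierStokesRegularity.NavierStokesRegularity.Theorems
open Summit.NavierStokesRegularity.NavierStokesRegularity.Theorems.GaussianGap
open Summit.NavierStokesRegularity.NavierStokesRegularity.Theorems.SimilarityEnstrophy
open Summit.NavierStokesRegularity.NavierStokesRegularity.Theorems.SmallDissipationGap
open Summit.NavierStokesRegularity.NavierStokesRegularity.Theorems.RecurrentReductionD
open Summit.NavierStokesRegularity.NavierStokesRegularity.Theorems.FiniteDissipationLiouville
open Summit.NavierStokesRegularity.NavierStokesRegularity.Theorems.FiniteDissipationLiouville.CrossFlow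

/-! ### Transport of the slab-piece convergence under a fixed rescaling -/

section Transport

/-- **Uniform convergence on the slab pieces passes to a fixed parabolic rescaling.** If
`v_j → W` uniformly on every slab piece `[−(n+2), −1/(n+2)] × B̄(0, n+2)`, then for every `c > 0`
`(v_j)_c → W_c` uniformly on every slab piece (`V_c(t,x) = c V(c²t, cx)`; the dilated piece lies
in a larger piece). [folklore] -/
theorem tendstoUniformlyOn_slabPieces_nsRescale
    {v : ℕ → ℝ → EuclideanSpace ℝ (Fin 3) → EuclideanSpace ℝ (Fin 3)}
    {W : ℝ → EuclideanSpace ℝ (Fin 3) → EuclideanSpace ℝ (Fin 3)}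
    (hunif : ∀ n : ℕ, TendstoUniformlyOn (fun j z => v j z.1 z.2) (fun z => W z.1 z.2) atTop
      (Icc (-((n : ℝ) + 2)) (-(1 / ((n : ℝ) + 2))) ×ˢ
        closedBall (0 : EuclideanSpace ℝ (Fin 3)) ((n : ℝ) + 2)))
    {c : ℝ} (hc : 0 < c) (n : ℕ) :
    TendstoUniformlyOn (fun j z => nsRescale c (v j) z.1 z.2) (fun z => nsRescale c W z.1 z.2) atTop
      (Icc (-((n : ℝ) + 2)) (-(1 / ((n : ℝ) + 2))) ×ˢ
        closedBall (0 : EuclideanSpace ℝ (Fin 3)) ((n : ℝ) + 2)) := by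
  obtain ⟨m, hm⟩ := HullCategory.slabPiece_mapsTo_dilate hc n
  rw [Metric.tendstoUniformlyOn_iff]
  intro ε hε
  filter_upwards [Metric.tendstoUniformlyOn_iff.1 (hunif m) (ε / c) (div_pos hε hc)] with j hj z hz
  have h1 := hj (c ^ 2 * z.1, c • z.2) (hm hz)
  rw [nsRescale_apply, nsRescale_apply, dist_smul₀, Real.norm_of_nonneg hc.le]
  calc c * dist (W (c ^ 2 * z.1) (c • z.2)) (v j (c ^ 2 * z.1) (c • z.2))
      < c * (ε / c) := mul_lt_mul_of_pos_left h1 hc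
    _ = ε := mul_div_cancel₀ _ hc.ne'

/-- **Chain rule for the vorticity gradient under rescaling**:
`D(curl V_c(s))(x) = c³ • D(curl V(c²s))(cx)` (hypothesis-free forms of the chain rule). [folklore] -/
theorem fderiv_curl_nsRescale (c : ℝ) (u : ℝ → EuclideanSpace ℝ (Fin 3) → EuclideanSpace ℝ (Fin 3))
    (s : ℝ) (x : EuclideanSpace ℝ (Fin 3)) :
    fderiv ℝ (curl (nsRescale c u s)) x = (c * c * c) • fderiv ℝ (curl (u (c ^ 2 * s))) (c • x) := by
  have e : curl (nsRescale c u s) =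
      (c * c) • (fun y : EuclideanSpace ℝ (Fin 3) => curl (u (c ^ 2 * s)) (c • y)) := by
    funext y
    rw [Pi.smul_apply, curl_eq_curlCLM, curl_eq_curlCLM, fderiv_nsRescale, map_smul]
  rw [e, fderiv_const_smul_field, Pi.smul_apply,
    show (fun y : EuclideanSpace ℝ (Fin 3) => curl (u (c ^ 2 * s)) (c • y)) =
      (curl (u (c ^ 2 * s)) <| c • ·) from rfl,
    _root_.fderiv_comp_smul, smul_smul]

/-- **`curl curl V_c(s)(x) = c³ • curl curl V(c²s)(cx)`.** [folklore] -/
theorem curl_curl_nsRescale (c : ℝ) (u : ℝ → EuclideanSpace ℝ (Fin 3) → EuclideanSpace ℝ (Fin 3))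
    (s : ℝ) (x : EuclideanSpace ℝ (Fin 3)) :
    curl (curl (nsRescale c u s)) x = (c * c * c) • curl (curl (u (c ^ 2 * s))) (c • x) := by
  rw [curl_eq_curlCLM, fderiv_curl_nsRescale, map_smul, ← curl_eq_curlCLM]

end Transport

/-! ### Second vorticity derivatives converge at every time -/

section SecondDerivatives

variable {C : ℝ}

/-- **The vorticity gradients converge pointwise at EVERY `t < 0`.** For Type-I ancient mild
`v j`, `W` with a common constant, `v j → W` uniformly on the slab pieces: for every `t < 0`, `x`,
`D(curl v_j(t))(x) → D(curl W(t))(x)` — g14's `tendsto_fderiv_curl_slice` (slice `t = −1`) applied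
to the rescalings by `c = √(−t)`. [cite: KochNadirashviliSereginSverak2009, Prop. 4.1 (arXiv:0709.3599 p. 8)] -/
theorem tendsto_fderiv_curl_of_unif {v : ℕ → ℝ → EuclideanSpace ℝ (Fin 3) → EuclideanSpace ℝ (Fin 3)}
    {W : ℝ → EuclideanSpace ℝ (Fin 3) → EuclideanSpace ℝ (Fin 3)}
    (hv : ∀ j, IsTypeIAncientMild C (v j)) (hW : IsTypeIAncientMild C W)
    (hunif : ∀ n : ℕ, TendstoUniformlyOn (fun j z => v j z.1 z.2) (fun z => W z.1 z.2) atTop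
      (Icc (-((n : ℝ) + 2)) (-(1 / ((n : ℝ) + 2))) ×ˢ
        closedBall (0 : EuclideanSpace ℝ (Fin 3)) ((n : ℝ) + 2)))
    {t : ℝ} (ht : t < 0) (x : EuclideanSpace ℝ (Fin 3)) :
    Tendsto (fun j => fderiv ℝ (curl (v j t)) x) atTop (𝓝 (fderiv ℝ (curl (W t)) x)) := by
  set c : ℝ := Real.sqrt (-t) with hcdef
  have hc : 0 < c := Real.sqrt_pos.2 (neg_pos.2 ht)
  have hc2 : c ^ 2 * (-1) = t := by rw [hcdef, Real.sq_sqrt (neg_pos.2 ht).le]; ring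
  have hc3 : c * c * c ≠ 0 := by positivity
  -- the rescaled sequence converges uniformly on the slab pieces
  have hv' : ∀ j, IsTypeIAncientMild C (nsRescale c (v j)) := fun j => (hv j).nsRescale hc
  have hW' : IsTypeIAncientMild C (nsRescale c W) := hW.nsRescale hc
  have hunif' := tendstoUniformlyOn_slabPieces_nsRescale hunif hc
  have h := ThresholdOne.tendsto_fderiv_curl_slice hv' hW' hunif' (c⁻¹ • x)
  simp only [fderiv_curl_nsRescale, hc2, smul_smul, mul_inv_cancel₀ hc.ne', one_smul] at h
  have h2 := h.const_smul (c * c * c)⁻¹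
  simp only [smul_smul, inv_mul_cancel₀ hc3, one_smul] at h2
  exact h2

/-- **The second vorticity derivatives (`curl curl`) converge pointwise at every `t < 0`** along
such a sequence. [cite: KochNadirashviliSereginSverak2009, Prop. 4.1 (arXiv:0709.3599 p. 8)] -/
theorem tendsto_curl_curl_of_unif {v : ℕ → ℝ → EuclideanSpace ℝ (Fin 3) → EuclideanSpace ℝ (Fin 3)}
    {W : ℝ → EuclideanSpace ℝ (Fin 3) → EuclideanSpace ℝ (Fin 3)}
    (hv : ∀ j, IsTypeIAncientMild C (v j)) (hW : IsTypeIAncientMild C W)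
    (hunif : ∀ n : ℕ, TendstoUniformlyOn (fun j z => v j z.1 z.2) (fun z => W z.1 z.2) atTop
      (Icc (-((n : ℝ) + 2)) (-(1 / ((n : ℝ) + 2))) ×ˢ
        closedBall (0 : EuclideanSpace ℝ (Fin 3)) ((n : ℝ) + 2)))
    {t : ℝ} (ht : t < 0) (x : EuclideanSpace ℝ (Fin 3)) :
    Tendsto (fun j => curl (curl (v j t)) x) atTop (𝓝 (curl (curl (W t)) x)) := by
  simp only [curl_eq_curlCLM (curl _)]
  exact (curlCLM.continuous.tendsto _).comp (tendsto_fderiv_curl_of_unif hv hW hunif ht x)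

/-- The first vorticities converge pointwise at every `t < 0` when the gradients do. [folklore] -/
theorem tendsto_curl_of_fderiv {v : ℕ → ℝ → EuclideanSpace ℝ (Fin 3) → EuclideanSpace ℝ (Fin 3)}
    {W : ℝ → EuclideanSpace ℝ (Fin 3) → EuclideanSpace ℝ (Fin 3)} {t : ℝ}
    {x : EuclideanSpace ℝ (Fin 3)}
    (hgr : Tendsto (fun j => fderiv ℝ (v j t) x) atTop (𝓝 (fderiv ℝ (W t) x))) :
    Tendsto (fun j => curl (v j t) x) atTop (𝓝 (curl (W t) x)) := by
  simp only [curl_eq_curlCLM]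
  exact (curlCLM.continuous.tendsto _).comp hgr

end SecondDerivatives

/-! ### The scheme -/

section Scheme

variable {C : ℝ}

/-- **THE ANTITONE-ENSTROPHY ENDPOINT SCHEME.** Let `P` be a property of space–time fields which is
(i) invariant under the parabolic rescalings `V ↦ V_c`, `c > 0`; (ii) closed under the KNSS
convergence of `…Compactness.seqLimit` inside the enveloped class with constant `C` (uniform on
the slab pieces, pointwise, pointwise gradients); (iii) such that every enveloped member with `P`
has ANTITONE global similarity enstrophy `s ↦ ∫‖Ω(s)‖²`; (iv) such that every enveloped member with
`P` and CONSTANT similarity enstrophy vanishes. Then every KNSS-gauge Type-I ancient mild field `V`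
(`IsTypeIAncientMild C V`) with a Type-I envelope `HasTypeIDecay C V` and `P V` vanishes identically
on `t < 0`. (Lead g17's proof of `…CrossFlow.eq_zero_of_crossFlow_le_one`, abstracted.)
[folklore energy method + KNSS compactness] -/
theorem eq_zero_of_antitone_scheme
    {P : (ℝ → EuclideanSpace ℝ (Fin 3) → EuclideanSpace ℝ (Fin 3)) → Prop}
    (hscale : ∀ (V : ℝ → EuclideanSpace ℝ (Fin 3) → EuclideanSpace ℝ (Fin 3)) (c : ℝ), 0 < c →
      P V → P (nsRescale c V))
    (hclosed : ∀ (u : ℕ → ℝ → EuclideanSpace ℝ (Fin 3) → EuclideanSpace ℝ (Fin 3))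
        (W : ℝ → EuclideanSpace ℝ (Fin 3) → EuclideanSpace ℝ (Fin 3)),
      (∀ j, IsTypeIAncientMild C (u j)) → (∀ j, HasTypeIDecay C (u j)) → (∀ j, P (u j)) →
      IsTypeIAncientMild C W →
      (∀ n : ℕ, TendstoUniformlyOn (fun j z => u j z.1 z.2) (fun z => W z.1 z.2) atTop
        (Icc (-((n : ℝ) + 2)) (-(1 / ((n : ℝ) + 2))) ×ˢ
          closedBall (0 : EuclideanSpace ℝ (Fin 3)) ((n : ℝ) + 2))) →
      (∀ t < 0, ∀ x, Tendsto (fun j => u j t x) atTop (𝓝 (W t x))) →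
      (∀ t < 0, ∀ x, Tendsto (fun j => fderiv ℝ (u j t) x) atTop (𝓝 (fderiv ℝ (W t) x))) →
      P W)
    (hanti : ∀ (V : ℝ → EuclideanSpace ℝ (Fin 3) → EuclideanSpace ℝ (Fin 3)),
      IsTypeIAncientMild C V → HasTypeIDecay C V → P V →
      Antitone fun σ => ∫ y, ‖lerayVorticity V σ y‖ ^ 2)
    (hconst : ∀ (V : ℝ → EuclideanSpace ℝ (Fin 3) → EuclideanSpace ℝ (Fin 3)),
      IsTypeIAncientMild C V → HasTypeIDecay C V → P V →
      (∀ s s' : ℝ, (∫ y, ‖lerayVorticity V s y‖ ^ 2) = ∫ y, ‖lerayVorticity V s' y‖ ^ 2) →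
      ∀ t < 0, ∀ x, V t x = 0)
    {V : ℝ → EuclideanSpace ℝ (Fin 3) → EuclideanSpace ℝ (Fin 3)}
    (hV : IsTypeIAncientMild C V) (hdec : HasTypeIDecay C V) (hP : P V) :
    ∀ t < 0, ∀ x, V t x = 0 := by
  -- adapted from Theorems/…CrossFlowThreshold.lean (`eq_zero_of_crossFlow_le_one`, lead g17)
  obtain ⟨C₁, C₂, C₃, hD1, hD2, -⟩ := IsTypeIAncientMild.gaugeBounds_of_hasTypeIDecay hV hdec
  -- the global similarity enstrophy: antitone and bounded, hence convergent at `−∞`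
  obtain ⟨Z, hZdef⟩ : ∃ Z : ℝ → ℝ, Z = fun σ => ∫ y, ‖lerayVorticity V σ y‖ ^ 2 := ⟨_, rfl⟩
  have hZσ : ∀ σ, Z σ = ∫ y, ‖lerayVorticity V σ y‖ ^ 2 := fun σ => by rw [hZdef]
  have hanti' : Antitone Z := by rw [hZdef]; exact hanti V hV hdec hP
  have hcontB : Continuous fun y : EuclideanSpace ℝ (Fin 3) =>
      (‖curlCLM‖ * C₁) ^ 2 * (1 + ‖y‖) ^ (-(4 : ℝ)) :=
    continuous_const.mul ((continuous_const.add continuous_norm).rpow_const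
      fun y => Or.inl (add_pos_of_pos_of_nonneg one_pos (norm_nonneg y)).ne')
  have imaj : Integrable fun y : EuclideanSpace ℝ (Fin 3) =>
      (‖curlCLM‖ * C₁) ^ 2 * (1 + ‖y‖) ^ (-(4 : ℝ)) :=
    integrable_of_le_decay_four hcontB (K := (‖curlCLM‖ * C₁) ^ 2) fun y => by
      rw [Real.norm_of_nonneg (by positivity)]
  have hbdd : BddAbove (range Z) := by
    refine ⟨∫ y : EuclideanSpace ℝ (Fin 3), (‖curlCLM‖ * C₁) ^ 2 * (1 + ‖y‖) ^ (-(4 : ℝ)), ?_⟩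
    rintro _ ⟨σ, rfl⟩
    rw [hZσ]
    refine integral_mono (integrable_norm_lerayVorticity_sq hV hD1 σ) imaj fun y => ?_
    have h := norm_lerayVorticity_le_decay hV hD1 σ y
    calc ‖lerayVorticity V σ y‖ ^ 2 ≤ (‖curlCLM‖ * C₁ * (1 + ‖y‖) ^ (-(2 : ℝ))) ^ 2 :=
          pow_le_pow_left₀ (norm_nonneg _) h 2
      _ = (‖curlCLM‖ * C₁) ^ 2 * ((1 + ‖y‖) ^ (-(2 : ℝ)) * (1 + ‖y‖) ^ (-(2 : ℝ))) := by ring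
      _ = (‖curlCLM‖ * C₁) ^ 2 * (1 + ‖y‖) ^ (-(4 : ℝ)) := by
          rw [← Real.rpow_add (by positivity)]; norm_num
  obtain ⟨m, hmdef⟩ : ∃ m : ℝ, m = ⨆ σ, Z σ := ⟨_, rfl⟩
  have hm : Tendsto Z atBot (𝓝 m) := by rw [hmdef]; exact tendsto_atBot_ciSup hanti' hbdd
  -- the zoom-out sequence and its KNSS limit
  obtain ⟨u, hudef⟩ : ∃ u : ℕ → ℝ → EuclideanSpace ℝ (Fin 3) → EuclideanSpace ℝ (Fin 3),
      ∀ j, u j = nsRescale (Real.exp j) V := ⟨_, fun j => rfl⟩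
  have hu : ∀ j, IsTypeIAncientMild C (u j) := fun j => by
    rw [hudef]; exact hV.nsRescale (Real.exp_pos _)
  have hdu : ∀ j, HasTypeIDecay C (u j) := fun j => by
    rw [hudef]; exact hdec.nsRescale (Real.exp_pos _)
  have hPu : ∀ j, P (u j) := fun j => by rw [hudef]; exact hscale V _ (Real.exp_pos _) hP
  obtain ⟨ψ, hψ, W, hW, hunif, hpt, hgr⟩ := Compactness.seqLimit hu
  have hψt : Tendsto (fun j => ((ψ j : ℕ) : ℝ)) atTop atTop :=
    tendsto_natCast_atTop_atTop.comp hψ.tendsto_atTop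
  -- the limit inherits the envelope and the property `P`
  have hdW : HasTypeIDecay C W := fun t ht x =>
    le_of_tendsto (hpt t ht x).norm (Eventually.of_forall fun j => hdu (ψ j) t ht x)
  have hPW : P W := hclosed (fun j => u (ψ j)) W (fun j => hu _) (fun j => hdu _) (fun j => hPu _)
    hW hunif hpt hgr
  -- every slice of `W` carries the enstrophy `m`
  have hZW : ∀ σ : ℝ, (∫ y, ‖lerayVorticity W (-σ) y‖ ^ 2) = m := by
    intro σ
    obtain ⟨c, hcdef⟩ : ∃ c : ℝ, c = Real.exp (σ / 2) := ⟨_, rfl⟩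
    have hc : 0 < c := by rw [hcdef]; exact Real.exp_pos _
    have hlogc : 2 * Real.log c = σ := by rw [hcdef, Real.log_exp]; ring
    have hc2 : c ^ 2 * (-1) < 0 := by
      have : 0 < c ^ 2 := by positivity
      linarith
    obtain ⟨u', hu'def⟩ : ∃ u' : ℕ → ℝ → EuclideanSpace ℝ (Fin 3) → EuclideanSpace ℝ (Fin 3),
        ∀ j, u' j = nsRescale c (u (ψ j)) := ⟨_, fun j => rfl⟩
    have hu' : ∀ j, IsTypeIAncientMild C (u' j) := fun j => by
      rw [hu'def]; exact (hu (ψ j)).nsRescale hc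
    have hdu' : ∀ j, HasTypeIDecay C (u' j) := fun j => by
      rw [hu'def]; exact (hdu (ψ j)).nsRescale hc
    have hgr' : ∀ x, Tendsto (fun j => fderiv ℝ (u' j (-1)) x) atTop
        (𝓝 (fderiv ℝ (nsRescale c W (-1)) x)) := by
      intro x
      simp only [hu'def, fderiv_nsRescale]
      exact (hgr _ hc2 (c • x)).const_smul (c * c)
    have hlim := tendsto_integral_sq_norm_curl_neg_one hu' hdu' hgr'
    have e1 : ∀ j, (∫ x, ‖curl (u' j (-1)) x‖ ^ 2) = Z (-σ - 2 * (ψ j : ℝ)) := by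
      intro j
      rw [← enstrophy_zero_eq, hu'def, enstrophy_nsRescale hc, hudef,
        enstrophy_nsRescale (Real.exp_pos _), Real.log_exp, hlogc, hZσ]
      congr 2
      ring
    have e2 : (∫ x, ‖curl (nsRescale c W (-1)) x‖ ^ 2) = ∫ y, ‖lerayVorticity W (-σ) y‖ ^ 2 := by
      rw [← enstrophy_zero_eq, enstrophy_nsRescale hc, hlogc, zero_sub]
    rw [e2] at hlim
    simp_rw [e1] at hlim
    have harg : Tendsto (fun j => -σ - 2 * (ψ j : ℝ)) atTop atBot := by
      have h2 : Tendsto (fun j => (-2) * (ψ j : ℝ)) atTop atBot :=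
        hψt.const_mul_atTop_of_neg (by norm_num)
      have h3 := tendsto_atBot_add_const_left atTop (-σ) h2
      refine h3.congr fun j => ?_
      ring
    exact tendsto_nhds_unique hlim (hm.comp harg)
  have hZW' : ∀ s : ℝ, (∫ y, ‖lerayVorticity W s y‖ ^ 2) = m := fun s => by
    have := hZW (-s); rwa [neg_neg] at this
  -- constant enstrophy: the limit vanishes, so `m = 0`
  have hW0 : ∀ t < 0, ∀ x, W t x = 0 :=
    hconst W hW hdW hPW fun s s' => by rw [hZW' s, hZW' s']
  have hm0 : m = 0 := by
    rw [← hZW' 0, enstrophy_zero_eq]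
    have : W (-1) = fun _ => 0 := funext fun x => hW0 (-1) (by norm_num) x
    simp [this, curl_eq_curlCLM]
  -- hence `Z_V ≡ 0` and `V ≡ 0`
  have hZle : ∀ σ, Z σ ≤ m := fun σ => by rw [hmdef]; exact le_ciSup hbdd σ
  have hΩ0 : ∀ s y, lerayVorticity V s y = 0 := by
    intro s
    have hcΩ : Continuous (lerayVorticity V s) := (contDiff_lerayVorticity_slice hV s).continuous
    have hE : ∫ y, ‖lerayVorticity V s y‖ ^ 2 = 0 := by
      have h1 := hZle s
      rw [hm0, hZσ] at h1
      exact le_antisymm h1 (integral_nonneg fun y => sq_nonneg _)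
    have hae : (fun y => ‖lerayVorticity V s y‖ ^ 2) =ᵐ[volume] 0 :=
      (integral_eq_zero_iff_of_nonneg (fun y => sq_nonneg _)
        (integrable_norm_lerayVorticity_sq hV hD1 s)).1 hE
    have hev : (fun y => ‖lerayVorticity V s y‖ ^ 2) = fun _ => (0 : ℝ) :=
      ((hcΩ.norm.pow 2).ae_eq_iff_eq (μ := volume) continuous_const).1 hae
    intro y
    have hy := congrFun hev y
    have : ‖lerayVorticity V s y‖ = 0 := pow_eq_zero_iff (n := 2) (by norm_num) |>.1 hy
    exact norm_eq_zero.1 this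
  have hcurl : ∀ t < 0, ∀ x, curl (V t) x = 0 := by
    intro t ht x
    set s : ℝ := -Real.log (-t) with hs
    have hts : -Real.exp (-s) = t := by
      rw [hs, neg_neg, Real.exp_log (neg_pos.2 ht), neg_neg]
    have h := hΩ0 s ((Real.exp (-s / 2))⁻¹ • x)
    rw [lerayVorticity_apply, curl_lerayOrbit, smul_smul,
      mul_inv_cancel₀ (Real.exp_pos _).ne', one_smul, hts, smul_eq_zero] at h
    exact h.resolve_left (Real.exp_pos _).ne'
  have hconstV : ∀ t < 0, ∀ x, V t x = V t 0 := fun t ht x =>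
    eq_of_curl_eq_zero_of_isDivFree_of_bounded ((hV.contDiff_slice ht).of_le (by norm_cast))
      (hcurl t ht) (hV.isDivFree ht) (fun z => hV.norm_le ht z) x 0
  exact fun t ht x => hV.eq_zero_of_slice_const (b := fun t => V t 0) hconstV ht x

end Scheme

end Summit.NavierStokesRegularity.NavierStokesRegularity.Theorems.FiniteDissipationLiouville.EndpointScheme

end
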